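import Literature.NumberTheory.Rogawski1990.ShalikaGermExpansionHoweReduction          -- ★ p848172 SH-3 (LH4-p03 (g0)): THE PLUG `UnitaryGroup.shalikaGermExpansionNonsplit_of_howePackage` (brings SH-1 ★ p848018, SH-2 ★ p848037, the local currency)
import Literature.NumberTheory.Rogawski1990.UnipotentOrbitalIntegralDualPiecesCM          -- ★ p849114 ‹DUAL› organ PAID (LH4-p02 (g2))
import Literature.NumberTheory.Rogawski1990.UnitaryThreeUnipotentClassesFiniteCM          -- ★ p849177 ‹U-FIN› organ PAID (LH5-p02 (g2))
import Literature.NumberTheory.Rogawski1990.LocalTransferIdentityCoreResidualStatementsOdd  -- ★ p849113 (LH4-p02 (g2)): `N6nsShalikaOddStatement` — the NARROWED row type BY NAME (desk condition (c))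
import Literature.NumberTheory.Rogawski1990.UnipotentOrbitalMeasuresExistCM             -- ★ p849138 RAO-EX (LH3-p02 (g0)): `…exists_orbitalMeasureFamily_isAdmissibleOn_unipotent_antidiagOne_three_odd`
import Literature.NumberTheory.Rogawski1990.UnipotentOrbitalMeasuresExistUncondCM        -- ★ p849258 RAO-EX-UNCOND (LH4-p03 (g3)): `…_odd'` (existence with `hcent` discharged by ★ p849215 CENT-BDD)
import Literature.NumberTheory.Rogawski1990.UnipotentOrbitalIntegralConvergenceCM         -- ★ p849278 FILE 4 ED. 1 (LH7-p01 (g2)): the three-way split `…_of_unipotent_of_cases` (`γ = 1` case proved inside)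
import Literature.NumberTheory.Rogawski1990.UnipotentOrbitalIntegralConvergenceSingularCM -- ★ p849351 (LH10-p01 (g2)): `UnitaryGroup.integrable_descConj_of_isLocSmooth_of_transvection` (singular case, hypothesis-free, over ★ p849314 + ★ p849303)
import Literature.NumberTheory.Rogawski1990.UnipotentOrbitalIntegralConvergenceRegularCM  -- ★ p849508 (C) ED. 3 (LH7-p01 (g2)): `UnitaryGroup.integrable_descConj_of_isLocSmooth_of_regular_unipotent` (regular case, hypothesis-free, over ★ (I)(II)(II-S)(B)(A1)(A2) + ★ p849303)
import Literature.MeasureTheory.Group.OrbitalIntegralKernelDecomposition                  -- ★ p849233 SPAN-e FILE B (LH7-p01 (g2)): `exists_add_mem_span_conj_sub_of_classOrbitalIntegral_eq_zero` (Howe's span property, generic)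
import Literature.NumberTheory.Rogawski1990.UnitaryThreeUnipotentClosedFiltrationCM    -- ★ p849265 (LH3-p02 (g0)): `exists_enum_unipotent_isClosed_iUnion_lt_antidiagOne_odd` (= `hfilt`, over ★ p849223 (S1)(S2) + ★ p849243), `npow_conj_sub_one_eq_zero_iff`
import Literature.NumberTheory.Rogawski1990.LocalTransferGlueCM                        -- ★ `totallyDisconnectedSpace_cmDatum_local` (SPAN-TIE glue)
import Literature.NumberTheory.Automorphic.AdicCompletionIntegerSpellings             -- ★ p849331 «𝒪-BRIDGE» (LH3-p02 (g0)): `isUnit_two_valuedInteger_of_isUnit_two` (leaf dialect `ValuativeRel` → `Valued`)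
import Literature.NumberTheory.Automorphic.LocalUnitaryGroupCongr                       -- ★ `antidiagOne_isHermitian`, `isUnit_antidiagOne_det` (`Φ₃` hermitian, `det Φ₃ ≠ 0`)
import HarnessLib

/-!
# Crux `H413`, line LH4 «Shalika germs» — THE ★ TWIN OF THE SHALIKA LEAF: `n6nsShalikaOdd : N6nsShalikaOddStatement` — the Shalika germ expansion for `U(Φ₃)(L⁺_v)`
# at every ODD non-split place, PROVED IN-HOUSE from the four ★ organs ‹U-FIN› ‹RAO› ‹DUAL› ‹SPAN› through the ★ SH-3 plug (Rogawski 1990 Prop. 8.1.1; Howe; Ranga Rao)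

Cell `hodgecm-mathlib` (D-0151), FLOOR 0, crux item H413 = `stmt-HodgeConjecture-24833`, route of record `HCCMUnconditional`; squad F0∕P3c line LH4 (dealer LH4-plan (g2)), seat
LH10-p01 (g2), DEALER WORDS #59 (ii) on LEAD T12-30 + desk D65 «α-odd-★».  THEOREMS ONLY (no `def`, no instance, no notation, no named fact, no `sorry`); imports = ★ Literature
+ HarnessLib (no `Cruxes/**`, O50-1); `--supports stmt-HodgeConjecture-24833`.  This file is the by-import CONSUMABLE form of the Shalika pay-down leaf
`Cruxes/H413/Lines/F0_P3c_ShalikaPaydown.lean` ED. 1 (skeleton v7o 813ffb627ca0e988, sorries 0): the germ ∕ closer editions (`N6nsGerm` ED. 1.17 «α-odd», closer ED. 39 §2‴)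
consume THIS module by import and read `n6nsShalikaOdd` by name (the leaf is a workfile and is imported by nobody).

WHAT IS PROVED.  ★ `Literature.NumberTheory.Rogawski1990.N6nsShalikaOddStatement` (p849113, LH4-p02 (g2)) = «for every CM field `L`, every finite place `v` of `L⁺` NON-SPLIT in `L`
(`Subsingleton (PlacesOver L v)`) and ODD (`IsUnit (2 : 𝒪_w)`, `w ∣ v`), the Shalika germ expansion ★ `ShalikaGermExpansionNonsplit L Φ₃ v` holds» [Rogawski1990 Prop. 8.1.1;
HarishChandra1999 Thm. 8.1; Howe1974 Prop. 2; Rao1972].  PROOF = the composition `n6nsShalikaOdd_of_organs` (★ SH-3 plug `UnitaryGroup.shalikaGermExpansionNonsplit_of_howePackage`,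
p848172) fed with the four organs, each a ★ theorem of the tree:
* ‹U-FIN› ★ p849177 `unitaryThree_unipotent_conjClasses_finite_odd` (LH5-p02 (g2)) — the unipotent classes form a finite set;
* ‹RAO› (private `shRao_of_unipotent`): existence of an admissible orbital-measure family at the unipotent classes ★ p849258 `…_odd'` (LH3-p02 (g0) p849138 RAO-EX ∘ LH4-p03 (g3)
  p849215 CENT-BDD) and the RANGA-RAO CLAUSE ★ p849278 `…_of_unipotent_of_cases` (LH7-p01 (g2)) fed with the two ★ case heads — REGULAR ★ p849508
  `UnitaryGroup.integrable_descConj_of_isLocSmooth_of_regular_unipotent` (LH7-p01 over ★ p849481 LH5-p02, ★ p849437 LH7-p03, ★ p849367∕p849393∕p849314∕p849197 F0P3a-p09 (g4),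
  ★ p849341 LH4-p03, ★ p849269∕p849290∕p849396∕p849366 LH4-p02∕LH4-p01, ★ p849305∕p849331 LH5-p02∕LH3-p02) and SINGULAR ★ p849351
  `UnitaryGroup.integrable_descConj_of_isLocSmooth_of_transvection` (LH10-p01 (g2) over ★ p849314 + ★ p849303) (= ★ p849524 `…_of_unipotent`, inlined here as the composition);
* ‹DUAL› ★ p849114 `UnitaryGroup.exists_unipotentDualPieces_antidiagOne_odd` (LH4-p02 (g2));
* ‹SPAN› (private `shSpan_of_span`): HOWE'S SPAN PROPERTY ★ p849233 `exists_add_mem_span_conj_sub_of_classOrbitalIntegral_eq_zero` (LH7-p01 (g2), over ★ COINV-1 p849044∕p849065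
  LH4-p02) at the closed filtration of the unipotent classes ★ p849265 `exists_enum_unipotent_isClosed_iUnion_lt_antidiagOne_odd` (LH3-p02 (g0) over ★ p849223 U3-STRATA LH4-p01 (g0)
  + ★ p849243), `𝒪[L_w]` spelling bridge ★ p849331.
HONEST LABEL: HC_CM is proved only modulo the 7 printed citations (2 remaining: hLiu418 = stmt-HodgeConjecture-24832, h413 = stmt-HodgeConjecture-24833) until rung 0 closes; this
file proves the NARROWED row «N6ns-Shalika at ODD places» — the dyadic places remain the closer's PRINT row «DYADIC»; the books move only at the desk's TIE edition (ED. 39 §2‴).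

## References
* [Rogawski1990] J. Rogawski, *Automorphic Representations of Unitary Groups in Three Variables*, Ann. of Math. Stud. 123 (1990): §8.1 Prop. 8.1.1 pp. 112–113; §4.9 p. 54; §3.9 p. 32.
* [HarishChandra1999AdmissibleDistributions] Harish-Chandra, *Admissible Invariant Distributions on Reductive p-adic Groups*, AMS ULS 16 (1999): Thm. 8.1 p. 48, §3.1 p. 17.
* [Howe1974] R. Howe, *The Fourier transform and germs of characters*, Math. Ann. 208 (1974): Prop. 2.  [Rao1972] R. Ranga Rao, Ann. of Math. 96 (1972) 505–510.
* [BernsteinZelevinsky1976] I. N. Bernstein, A. V. Zelevinsky, Russian Math. Surveys 31:3 (1976): §1.5, §1.18.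
-/

set_option autoImplicit false
-- the mandated namespace repeats the single-problem summit's segment (`HodgeConjecture.HodgeConjecture`)
set_option linter.dupNamespace false

noncomputable section

namespace Summit.HodgeConjecture.HodgeConjecture.Cruxes.H413.F0P3cN6nsShalikaOdd

open MeasureTheory Measure NumberField IsDedekindDomain Topology Filter
open Literature.MeasureTheory.Group Literature.NumberTheory.Automorphic Literature.NumberTheory.Automorphic.UnitaryGroup
open Literature.NumberTheory.Rogawski1990 Literature.NumberTheory.GaloisRepresentations
open scoped Matrix MatrixGroups Classical ValuativeRel

/-! ## §1 The two composite organs ‹RAO› and ‹SPAN› as PRIVATE lemmas over ★ (no public restatement of ★ heads) -/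

set_option maxHeartbeats 400000 in
-- statement-heavy: four instance binders
/-- ‹RAO› — an ADMISSIBLE orbital-measure family at the unipotent classes of `U(Φ₃)(L⁺_v)` WITH THE RANGA-RAO CLAUSE, at an odd non-split place: existence ★ p849258 `…_odd'`,
the clause by ★ p849278's three-way split fed with the ★ REGULAR (p849508) and ★ SINGULAR (p849351) case heads. [cite: Rao1972, Theorem] [cite: Rogawski1990, §8.1 p. 112; §4.9 p. 54]
[cite: HarishChandra1999AdmissibleDistributions, §3.1 p. 17] -/
private theorem shRao_of_unipotent :
    ∀ (L : Type) [Field L] [NumberField L] [IsCMField L] (v : HeightOneSpectrum (𝓞 ↥(maximalRealSubfield L))) (w : UnitaryGroup.PlacesOver L v),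
      Subsingleton (UnitaryGroup.PlacesOver L v) → IsUnit (2 : 𝒪[w.1.adicCompletion L]) →
      ∀ [MeasurableSpace ((cmDatum L 3 (Matrix.of fun i j : Fin 3 => if i.val + j.val + 1 = 3 then (1 : L) else 0)).Local v)] [BorelSpace ((cmDatum L 3 (Matrix.of fun i j : Fin 3 => if i.val + j.val + 1 = 3 then (1 : L) else 0)).Local v)]
        [∀ γ : ((cmDatum L 3 (Matrix.of fun i j : Fin 3 => if i.val + j.val + 1 = 3 then (1 : L) else 0)).Local v), MeasurableSpace (((cmDatum L 3 (Matrix.of fun i j : Fin 3 => if i.val + j.val + 1 = 3 then (1 : L) else 0)).Local v) ⧸ Subgroup.centralizer ({γ} : Set ((cmDatum L 3 (Matrix.of fun i j : Fin 3 => if i.val + j.val + 1 = 3 then (1 : L) else 0)).Local v)))]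
        [∀ γ : ((cmDatum L 3 (Matrix.of fun i j : Fin 3 => if i.val + j.val + 1 = 3 then (1 : L) else 0)).Local v), BorelSpace (((cmDatum L 3 (Matrix.of fun i j : Fin 3 => if i.val + j.val + 1 = 3 then (1 : L) else 0)).Local v) ⧸ Subgroup.centralizer ({γ} : Set ((cmDatum L 3 (Matrix.of fun i j : Fin 3 => if i.val + j.val + 1 = 3 then (1 : L) else 0)).Local v)))],
      ∃ mU : OrbitalMeasureFamily ((cmDatum L 3 (Matrix.of fun i j : Fin 3 => if i.val + j.val + 1 = 3 then (1 : L) else 0)).Local v),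
        mU.IsAdmissibleOn (fun γ : ((cmDatum L 3 (Matrix.of fun i j : Fin 3 => if i.val + j.val + 1 = 3 then (1 : L) else 0)).Local v) => (((γ).val : GL (Fin 3) (UnitaryGroup.LocalRing L v)).val - 1) ^ 3 = 0) ∧
        ∀ u : ConjClasses ((cmDatum L 3 (Matrix.of fun i j : Fin 3 => if i.val + j.val + 1 = 3 then (1 : L) else 0)).Local v), (((Quotient.out u : ((cmDatum L 3 (Matrix.of fun i j : Fin 3 => if i.val + j.val + 1 = 3 then (1 : L) else 0)).Local v)).val : GL (Fin 3) (UnitaryGroup.LocalRing L v)).val - 1) ^ 3 = 0 →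
          ∀ f : ((cmDatum L 3 (Matrix.of fun i j : Fin 3 => if i.val + j.val + 1 = 3 then (1 : L) else 0)).Local v) → ℂ, IsLocSmooth f →
            Integrable (descConj (Quotient.out u : ((cmDatum L 3 (Matrix.of fun i j : Fin 3 => if i.val + j.val + 1 = 3 then (1 : L) else 0)).Local v)) (Subgroup.centralizer ({(Quotient.out u : ((cmDatum L 3 (Matrix.of fun i j : Fin 3 => if i.val + j.val + 1 = 3 then (1 : L) else 0)).Local v))} : Set ((cmDatum L 3 (Matrix.of fun i j : Fin 3 => if i.val + j.val + 1 = 3 then (1 : L) else 0)).Local v)))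
              (fun _ hg => Subgroup.mem_centralizer_singleton_iff.1 hg) f) (mU u)  := by
  intro L _ _ _ v w hsub h2 _ _ _ _
  obtain ⟨mU, hmU, -⟩ := UnitaryGroup.exists_orbitalMeasureFamily_isAdmissibleOn_unipotent_antidiagOne_three_odd' L v w hsub h2
  refine ⟨mU, hmU, fun u hu f hf => ?_⟩
  obtain ⟨-, hinv, hfin⟩ := hmU u hu
  haveI := hinv
  haveI := hfin
  exact UnitaryGroup.integrable_descConj_of_isLocSmooth_of_unipotent_of_cases UnitaryGroup.integrable_descConj_of_isLocSmooth_of_regular_unipotent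
    (fun L _ _ _ v w hsub _ _ _ _ _ γ _ hsing hγ1 μ _ _ f hf => UnitaryGroup.integrable_descConj_of_isLocSmooth_of_transvection L v w hsub γ hsing hγ1 μ f hf)
    L v w hsub h2 (Quotient.out u) hu (mU u) f hf

set_option maxHeartbeats 400000 in
-- statement-heavy: four instance binders
/-- ‹SPAN› — HOWE'S SPAN PROPERTY for `U(Φ₃)(L⁺_v)` at an odd non-split place: ★ p849233 `exists_add_mem_span_conj_sub_of_classOrbitalIntegral_eq_zero` at `P γ := (γ − 1)³ = 0` with the
closed filtration ★ p849265 `exists_enum_unipotent_isClosed_iUnion_lt_antidiagOne_odd` (bridge ★ p849331), conjugation invariance ★ `npow_conj_sub_one_eq_zero_iff`, total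
disconnectedness ★ `totallyDisconnectedSpace_cmDatum_local`. [cite: Howe1974, Prop. 2] [cite: HarishChandra1999AdmissibleDistributions, Thm. 8.1 p. 48] [cite: BernsteinZelevinsky1976, §1.18]
[cite: Rogawski1990, §8.1 pp. 112–113] -/
private theorem shSpan_of_span :
    ∀ (L : Type) [Field L] [NumberField L] [IsCMField L] (v : HeightOneSpectrum (𝓞 ↥(maximalRealSubfield L))) (w : UnitaryGroup.PlacesOver L v),
      Subsingleton (UnitaryGroup.PlacesOver L v) → IsUnit (2 : 𝒪[w.1.adicCompletion L]) →
      ∀ [MeasurableSpace ((cmDatum L 3 (Matrix.of fun i j : Fin 3 => if i.val + j.val + 1 = 3 then (1 : L) else 0)).Local v)] [BorelSpace ((cmDatum L 3 (Matrix.of fun i j : Fin 3 => if i.val + j.val + 1 = 3 then (1 : L) else 0)).Local v)]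
        [∀ γ : ((cmDatum L 3 (Matrix.of fun i j : Fin 3 => if i.val + j.val + 1 = 3 then (1 : L) else 0)).Local v), MeasurableSpace (((cmDatum L 3 (Matrix.of fun i j : Fin 3 => if i.val + j.val + 1 = 3 then (1 : L) else 0)).Local v) ⧸ Subgroup.centralizer ({γ} : Set ((cmDatum L 3 (Matrix.of fun i j : Fin 3 => if i.val + j.val + 1 = 3 then (1 : L) else 0)).Local v)))]
        [∀ γ : ((cmDatum L 3 (Matrix.of fun i j : Fin 3 => if i.val + j.val + 1 = 3 then (1 : L) else 0)).Local v), BorelSpace (((cmDatum L 3 (Matrix.of fun i j : Fin 3 => if i.val + j.val + 1 = 3 then (1 : L) else 0)).Local v) ⧸ Subgroup.centralizer ({γ} : Set ((cmDatum L 3 (Matrix.of fun i j : Fin 3 => if i.val + j.val + 1 = 3 then (1 : L) else 0)).Local v)))],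
      ∀ (S : Finset (ConjClasses ((cmDatum L 3 (Matrix.of fun i j : Fin 3 => if i.val + j.val + 1 = 3 then (1 : L) else 0)).Local v))) (mU : OrbitalMeasureFamily ((cmDatum L 3 (Matrix.of fun i j : Fin 3 => if i.val + j.val + 1 = 3 then (1 : L) else 0)).Local v)),
        (∀ c : ConjClasses ((cmDatum L 3 (Matrix.of fun i j : Fin 3 => if i.val + j.val + 1 = 3 then (1 : L) else 0)).Local v), c ∈ S ↔ (((Quotient.out c : ((cmDatum L 3 (Matrix.of fun i j : Fin 3 => if i.val + j.val + 1 = 3 then (1 : L) else 0)).Local v)).val : GL (Fin 3) (UnitaryGroup.LocalRing L v)).val - 1) ^ 3 = 0) →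
        mU.IsAdmissibleOn (fun γ : ((cmDatum L 3 (Matrix.of fun i j : Fin 3 => if i.val + j.val + 1 = 3 then (1 : L) else 0)).Local v) => (ConjClasses.mk γ) ∈ S) →
        (∀ u ∈ S, ∀ f : ((cmDatum L 3 (Matrix.of fun i j : Fin 3 => if i.val + j.val + 1 = 3 then (1 : L) else 0)).Local v) → ℂ, IsLocSmooth f →
            Integrable (descConj (Quotient.out u : ((cmDatum L 3 (Matrix.of fun i j : Fin 3 => if i.val + j.val + 1 = 3 then (1 : L) else 0)).Local v)) (Subgroup.centralizer ({(Quotient.out u : ((cmDatum L 3 (Matrix.of fun i j : Fin 3 => if i.val + j.val + 1 = 3 then (1 : L) else 0)).Local v))} : Set ((cmDatum L 3 (Matrix.of fun i j : Fin 3 => if i.val + j.val + 1 = 3 then (1 : L) else 0)).Local v)))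
              (fun _ hg => Subgroup.mem_centralizer_singleton_iff.1 hg) f) (mU u)) →
        ∀ F : ((cmDatum L 3 (Matrix.of fun i j : Fin 3 => if i.val + j.val + 1 = 3 then (1 : L) else 0)).Local v) → ℂ, IsLocSmooth F → (∀ u ∈ S, classOrbitalIntegral mU F u = 0) →
          ∃ F₀ F₁ : ((cmDatum L 3 (Matrix.of fun i j : Fin 3 => if i.val + j.val + 1 = 3 then (1 : L) else 0)).Local v) → ℂ, F = F₀ + F₁ ∧
            F₀ ∈ Submodule.span ℂ {ψ : ((cmDatum L 3 (Matrix.of fun i j : Fin 3 => if i.val + j.val + 1 = 3 then (1 : L) else 0)).Local v) → ℂ |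
              ∃ (x : ((cmDatum L 3 (Matrix.of fun i j : Fin 3 => if i.val + j.val + 1 = 3 then (1 : L) else 0)).Local v)) (φ : ((cmDatum L 3 (Matrix.of fun i j : Fin 3 => if i.val + j.val + 1 = 3 then (1 : L) else 0)).Local v) → ℂ), IsLocSmooth φ ∧ ψ = (fun g => φ (x * g * x⁻¹)) - φ} ∧
            ∀ g ∈ tsupport F₁, (((g).val : GL (Fin 3) (UnitaryGroup.LocalRing L v)).val - 1) ^ 3 ≠ 0  := by
  intro L _ _ _ v w hsub h2 _ _ _ _ S mU hS hmU hRao F hF h0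
  haveI : TotallyDisconnectedSpace ((cmDatum L 3 (Matrix.of fun i j : Fin 3 => if i.val + j.val + 1 = 3 then (1 : L) else 0)).Local v) :=
    totallyDisconnectedSpace_cmDatum_local L 3 _ v
  obtain ⟨n, e, he, hcl⟩ := exists_enum_unipotent_isClosed_iUnion_lt_antidiagOne_odd L v w hsub (isUnit_two_valuedInteger_of_isUnit_two L w.1 h2) S hS
  exact exists_add_mem_span_conj_sub_of_classOrbitalIntegral_eq_zero
    (fun γ : ((cmDatum L 3 (Matrix.of fun i j : Fin 3 => if i.val + j.val + 1 = 3 then (1 : L) else 0)).Local v) => ((γ.val : GL (Fin 3) (UnitaryGroup.LocalRing L v)).val - 1) ^ 3 = 0) S hS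
    (fun g x => npow_conj_sub_one_eq_zero_iff L _ v g x 3) ⟨n, e, he, hcl⟩ mU hmU hRao F hF h0

/-! ## §2 The composition and the head `n6nsShalikaOdd : N6nsShalikaOddStatement` -/

set_option maxHeartbeats 800000 in
-- statement-heavy: four organ texts as hypotheses
/-- **`n6nsShalikaOdd_of_organs` : ‹U-FIN› → ‹RAO› → ‹DUAL› → ‹SPAN› → «Shalika at `Φ₃` at every ODD non-split place»** (= the leaf's head composition, byte-identical): at `(L, v)`
take `S` from ‹U-FIN›, `mU` from ‹RAO› (admissible on `S` because `c ∈ S ↔ γ_c` unipotent and `⟦γ_c⟧ = c`), `fd` from ‹DUAL›, the span property from ‹SPAN›, and apply ★ SH-3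
`UnitaryGroup.shalikaGermExpansionNonsplit_of_howePackage` with ★ `antidiagOne_isHermitian L 3`, ★ `(isUnit_antidiagOne_det L 3).ne_zero`.
[cite: Rogawski1990, §8.1 Prop. 8.1.1 pp. 112–113] [cite: Howe1974, Prop. 2] [cite: Rao1972] -/
theorem n6nsShalikaOdd_of_organs
    (hfin :
    ∀ (L : Type) [Field L] [NumberField L] [IsCMField L] (v : HeightOneSpectrum (𝓞 ↥(maximalRealSubfield L))) (w : UnitaryGroup.PlacesOver L v),
      Subsingleton (UnitaryGroup.PlacesOver L v) → IsUnit (2 : 𝒪[w.1.adicCompletion L]) →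
      ∃ S : Finset (ConjClasses ((cmDatum L 3 (Matrix.of fun i j : Fin 3 => if i.val + j.val + 1 = 3 then (1 : L) else 0)).Local v)), ∀ c : ConjClasses ((cmDatum L 3 (Matrix.of fun i j : Fin 3 => if i.val + j.val + 1 = 3 then (1 : L) else 0)).Local v),
        c ∈ S ↔ (((Quotient.out c : ((cmDatum L 3 (Matrix.of fun i j : Fin 3 => if i.val + j.val + 1 = 3 then (1 : L) else 0)).Local v)).val : GL (Fin 3) (UnitaryGroup.LocalRing L v)).val - 1) ^ 3 = 0)
    (hrao :
    ∀ (L : Type) [Field L] [NumberField L] [IsCMField L] (v : HeightOneSpectrum (𝓞 ↥(maximalRealSubfield L))) (w : UnitaryGroup.PlacesOver L v),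
      Subsingleton (UnitaryGroup.PlacesOver L v) → IsUnit (2 : 𝒪[w.1.adicCompletion L]) →
      ∀ [MeasurableSpace ((cmDatum L 3 (Matrix.of fun i j : Fin 3 => if i.val + j.val + 1 = 3 then (1 : L) else 0)).Local v)] [BorelSpace ((cmDatum L 3 (Matrix.of fun i j : Fin 3 => if i.val + j.val + 1 = 3 then (1 : L) else 0)).Local v)]
        [∀ γ : ((cmDatum L 3 (Matrix.of fun i j : Fin 3 => if i.val + j.val + 1 = 3 then (1 : L) else 0)).Local v), MeasurableSpace (((cmDatum L 3 (Matrix.of fun i j : Fin 3 => if i.val + j.val + 1 = 3 then (1 : L) else 0)).Local v) ⧸ Subgroup.centralizer ({γ} : Set ((cmDatum L 3 (Matrix.of fun i j : Fin 3 => if i.val + j.val + 1 = 3 then (1 : L) else 0)).Local v)))]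
        [∀ γ : ((cmDatum L 3 (Matrix.of fun i j : Fin 3 => if i.val + j.val + 1 = 3 then (1 : L) else 0)).Local v), BorelSpace (((cmDatum L 3 (Matrix.of fun i j : Fin 3 => if i.val + j.val + 1 = 3 then (1 : L) else 0)).Local v) ⧸ Subgroup.centralizer ({γ} : Set ((cmDatum L 3 (Matrix.of fun i j : Fin 3 => if i.val + j.val + 1 = 3 then (1 : L) else 0)).Local v)))],
      ∃ mU : OrbitalMeasureFamily ((cmDatum L 3 (Matrix.of fun i j : Fin 3 => if i.val + j.val + 1 = 3 then (1 : L) else 0)).Local v),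
        mU.IsAdmissibleOn (fun γ : ((cmDatum L 3 (Matrix.of fun i j : Fin 3 => if i.val + j.val + 1 = 3 then (1 : L) else 0)).Local v) => (((γ).val : GL (Fin 3) (UnitaryGroup.LocalRing L v)).val - 1) ^ 3 = 0) ∧
        ∀ u : ConjClasses ((cmDatum L 3 (Matrix.of fun i j : Fin 3 => if i.val + j.val + 1 = 3 then (1 : L) else 0)).Local v), (((Quotient.out u : ((cmDatum L 3 (Matrix.of fun i j : Fin 3 => if i.val + j.val + 1 = 3 then (1 : L) else 0)).Local v)).val : GL (Fin 3) (UnitaryGroup.LocalRing L v)).val - 1) ^ 3 = 0 →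
          ∀ f : ((cmDatum L 3 (Matrix.of fun i j : Fin 3 => if i.val + j.val + 1 = 3 then (1 : L) else 0)).Local v) → ℂ, IsLocSmooth f →
            Integrable (descConj (Quotient.out u : ((cmDatum L 3 (Matrix.of fun i j : Fin 3 => if i.val + j.val + 1 = 3 then (1 : L) else 0)).Local v)) (Subgroup.centralizer ({(Quotient.out u : ((cmDatum L 3 (Matrix.of fun i j : Fin 3 => if i.val + j.val + 1 = 3 then (1 : L) else 0)).Local v))} : Set ((cmDatum L 3 (Matrix.of fun i j : Fin 3 => if i.val + j.val + 1 = 3 then (1 : L) else 0)).Local v)))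
              (fun _ hg => Subgroup.mem_centralizer_singleton_iff.1 hg) f) (mU u))
    (hdual :
    ∀ (L : Type) [Field L] [NumberField L] [IsCMField L] (v : HeightOneSpectrum (𝓞 ↥(maximalRealSubfield L))) (w : UnitaryGroup.PlacesOver L v),
      Subsingleton (UnitaryGroup.PlacesOver L v) → IsUnit (2 : 𝒪[w.1.adicCompletion L]) →
      ∀ [MeasurableSpace ((cmDatum L 3 (Matrix.of fun i j : Fin 3 => if i.val + j.val + 1 = 3 then (1 : L) else 0)).Local v)] [BorelSpace ((cmDatum L 3 (Matrix.of fun i j : Fin 3 => if i.val + j.val + 1 = 3 then (1 : L) else 0)).Local v)]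
        [∀ γ : ((cmDatum L 3 (Matrix.of fun i j : Fin 3 => if i.val + j.val + 1 = 3 then (1 : L) else 0)).Local v), MeasurableSpace (((cmDatum L 3 (Matrix.of fun i j : Fin 3 => if i.val + j.val + 1 = 3 then (1 : L) else 0)).Local v) ⧸ Subgroup.centralizer ({γ} : Set ((cmDatum L 3 (Matrix.of fun i j : Fin 3 => if i.val + j.val + 1 = 3 then (1 : L) else 0)).Local v)))]
        [∀ γ : ((cmDatum L 3 (Matrix.of fun i j : Fin 3 => if i.val + j.val + 1 = 3 then (1 : L) else 0)).Local v), BorelSpace (((cmDatum L 3 (Matrix.of fun i j : Fin 3 => if i.val + j.val + 1 = 3 then (1 : L) else 0)).Local v) ⧸ Subgroup.centralizer ({γ} : Set ((cmDatum L 3 (Matrix.of fun i j : Fin 3 => if i.val + j.val + 1 = 3 then (1 : L) else 0)).Local v)))],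
      ∀ (S : Finset (ConjClasses ((cmDatum L 3 (Matrix.of fun i j : Fin 3 => if i.val + j.val + 1 = 3 then (1 : L) else 0)).Local v))) (mU : OrbitalMeasureFamily ((cmDatum L 3 (Matrix.of fun i j : Fin 3 => if i.val + j.val + 1 = 3 then (1 : L) else 0)).Local v)),
        (∀ u ∈ S, (((Quotient.out u : ((cmDatum L 3 (Matrix.of fun i j : Fin 3 => if i.val + j.val + 1 = 3 then (1 : L) else 0)).Local v)).val : GL (Fin 3) (UnitaryGroup.LocalRing L v)).val - 1) ^ 3 = 0) →
        mU.IsAdmissibleOn (fun γ : ((cmDatum L 3 (Matrix.of fun i j : Fin 3 => if i.val + j.val + 1 = 3 then (1 : L) else 0)).Local v) => (ConjClasses.mk γ) ∈ S) →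
        (∀ u ∈ S, ∀ f : ((cmDatum L 3 (Matrix.of fun i j : Fin 3 => if i.val + j.val + 1 = 3 then (1 : L) else 0)).Local v) → ℂ, IsLocSmooth f →
            Integrable (descConj (Quotient.out u : ((cmDatum L 3 (Matrix.of fun i j : Fin 3 => if i.val + j.val + 1 = 3 then (1 : L) else 0)).Local v)) (Subgroup.centralizer ({(Quotient.out u : ((cmDatum L 3 (Matrix.of fun i j : Fin 3 => if i.val + j.val + 1 = 3 then (1 : L) else 0)).Local v))} : Set ((cmDatum L 3 (Matrix.of fun i j : Fin 3 => if i.val + j.val + 1 = 3 then (1 : L) else 0)).Local v)))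
              (fun _ hg => Subgroup.mem_centralizer_singleton_iff.1 hg) f) (mU u)) →
        ∃ fd : ConjClasses ((cmDatum L 3 (Matrix.of fun i j : Fin 3 => if i.val + j.val + 1 = 3 then (1 : L) else 0)).Local v) → ((cmDatum L 3 (Matrix.of fun i j : Fin 3 => if i.val + j.val + 1 = 3 then (1 : L) else 0)).Local v) → ℂ,
          (∀ u ∈ S, IsLocSmooth (fd u)) ∧ (∀ u ∈ S, classOrbitalIntegral mU (fd u) u = 1) ∧
          (∀ u ∈ S, ∀ u' ∈ S, u ≠ u' → classOrbitalIntegral mU (fd u') u = 0))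
    (hspan :
    ∀ (L : Type) [Field L] [NumberField L] [IsCMField L] (v : HeightOneSpectrum (𝓞 ↥(maximalRealSubfield L))) (w : UnitaryGroup.PlacesOver L v),
      Subsingleton (UnitaryGroup.PlacesOver L v) → IsUnit (2 : 𝒪[w.1.adicCompletion L]) →
      ∀ [MeasurableSpace ((cmDatum L 3 (Matrix.of fun i j : Fin 3 => if i.val + j.val + 1 = 3 then (1 : L) else 0)).Local v)] [BorelSpace ((cmDatum L 3 (Matrix.of fun i j : Fin 3 => if i.val + j.val + 1 = 3 then (1 : L) else 0)).Local v)]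
        [∀ γ : ((cmDatum L 3 (Matrix.of fun i j : Fin 3 => if i.val + j.val + 1 = 3 then (1 : L) else 0)).Local v), MeasurableSpace (((cmDatum L 3 (Matrix.of fun i j : Fin 3 => if i.val + j.val + 1 = 3 then (1 : L) else 0)).Local v) ⧸ Subgroup.centralizer ({γ} : Set ((cmDatum L 3 (Matrix.of fun i j : Fin 3 => if i.val + j.val + 1 = 3 then (1 : L) else 0)).Local v)))]
        [∀ γ : ((cmDatum L 3 (Matrix.of fun i j : Fin 3 => if i.val + j.val + 1 = 3 then (1 : L) else 0)).Local v), BorelSpace (((cmDatum L 3 (Matrix.of fun i j : Fin 3 => if i.val + j.val + 1 = 3 then (1 : L) else 0)).Local v) ⧸ Subgroup.centralizer ({γ} : Set ((cmDatum L 3 (Matrix.of fun i j : Fin 3 => if i.val + j.val + 1 = 3 then (1 : L) else 0)).Local v)))],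
      ∀ (S : Finset (ConjClasses ((cmDatum L 3 (Matrix.of fun i j : Fin 3 => if i.val + j.val + 1 = 3 then (1 : L) else 0)).Local v))) (mU : OrbitalMeasureFamily ((cmDatum L 3 (Matrix.of fun i j : Fin 3 => if i.val + j.val + 1 = 3 then (1 : L) else 0)).Local v)),
        (∀ c : ConjClasses ((cmDatum L 3 (Matrix.of fun i j : Fin 3 => if i.val + j.val + 1 = 3 then (1 : L) else 0)).Local v), c ∈ S ↔ (((Quotient.out c : ((cmDatum L 3 (Matrix.of fun i j : Fin 3 => if i.val + j.val + 1 = 3 then (1 : L) else 0)).Local v)).val : GL (Fin 3) (UnitaryGroup.LocalRing L v)).val - 1) ^ 3 = 0) →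
        mU.IsAdmissibleOn (fun γ : ((cmDatum L 3 (Matrix.of fun i j : Fin 3 => if i.val + j.val + 1 = 3 then (1 : L) else 0)).Local v) => (ConjClasses.mk γ) ∈ S) →
        (∀ u ∈ S, ∀ f : ((cmDatum L 3 (Matrix.of fun i j : Fin 3 => if i.val + j.val + 1 = 3 then (1 : L) else 0)).Local v) → ℂ, IsLocSmooth f →
            Integrable (descConj (Quotient.out u : ((cmDatum L 3 (Matrix.of fun i j : Fin 3 => if i.val + j.val + 1 = 3 then (1 : L) else 0)).Local v)) (Subgroup.centralizer ({(Quotient.out u : ((cmDatum L 3 (Matrix.of fun i j : Fin 3 => if i.val + j.val + 1 = 3 then (1 : L) else 0)).Local v))} : Set ((cmDatum L 3 (Matrix.of fun i j : Fin 3 => if i.val + j.val + 1 = 3 then (1 : L) else 0)).Local v)))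
              (fun _ hg => Subgroup.mem_centralizer_singleton_iff.1 hg) f) (mU u)) →
        ∀ F : ((cmDatum L 3 (Matrix.of fun i j : Fin 3 => if i.val + j.val + 1 = 3 then (1 : L) else 0)).Local v) → ℂ, IsLocSmooth F → (∀ u ∈ S, classOrbitalIntegral mU F u = 0) →
          ∃ F₀ F₁ : ((cmDatum L 3 (Matrix.of fun i j : Fin 3 => if i.val + j.val + 1 = 3 then (1 : L) else 0)).Local v) → ℂ, F = F₀ + F₁ ∧
            F₀ ∈ Submodule.span ℂ {ψ : ((cmDatum L 3 (Matrix.of fun i j : Fin 3 => if i.val + j.val + 1 = 3 then (1 : L) else 0)).Local v) → ℂ |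
              ∃ (x : ((cmDatum L 3 (Matrix.of fun i j : Fin 3 => if i.val + j.val + 1 = 3 then (1 : L) else 0)).Local v)) (φ : ((cmDatum L 3 (Matrix.of fun i j : Fin 3 => if i.val + j.val + 1 = 3 then (1 : L) else 0)).Local v) → ℂ), IsLocSmooth φ ∧ ψ = (fun g => φ (x * g * x⁻¹)) - φ} ∧
            ∀ g ∈ tsupport F₁, (((g).val : GL (Fin 3) (UnitaryGroup.LocalRing L v)).val - 1) ^ 3 ≠ 0) :
    ∀ (L : Type) [Field L] [NumberField L] [IsCMField L] (v : HeightOneSpectrum (𝓞 ↥(maximalRealSubfield L))) (w : UnitaryGroup.PlacesOver L v),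
      Subsingleton (UnitaryGroup.PlacesOver L v) → IsUnit (2 : 𝒪[w.1.adicCompletion L]) →
        ShalikaGermExpansionNonsplit L (Matrix.of fun i j : Fin 3 => if i.val + j.val + 1 = 3 then (1 : L) else 0) v := by
  intro L _ _ _ v w hsub h2
  refine UnitaryGroup.shalikaGermExpansionNonsplit_of_howePackage L (Matrix.of fun i j : Fin 3 => if i.val + j.val + 1 = 3 then (1 : L) else 0) v
    (antidiagOne_isHermitian L 3) (isUnit_antidiagOne_det L 3).ne_zero ?_
  intro _ _ _ _
  obtain ⟨S, hS⟩ := hfin L v w hsub h2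
  obtain ⟨mU, hadm, hraoU⟩ := hrao L v w hsub h2
  have hmk : ∀ c : ConjClasses ((cmDatum L 3 (Matrix.of fun i j : Fin 3 => if i.val + j.val + 1 = 3 then (1 : L) else 0)).Local v), ConjClasses.mk (Quotient.out c) = c := fun c => Quotient.out_eq c
  have hunip : ∀ u ∈ S, (((Quotient.out u : ((cmDatum L 3 (Matrix.of fun i j : Fin 3 => if i.val + j.val + 1 = 3 then (1 : L) else 0)).Local v)).val : GL (Fin 3) (UnitaryGroup.LocalRing L v)).val - 1) ^ 3 = 0 :=
    fun u hu => (hS u).1 hu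
  have hadmS : mU.IsAdmissibleOn (fun γ : ((cmDatum L 3 (Matrix.of fun i j : Fin 3 => if i.val + j.val + 1 = 3 then (1 : L) else 0)).Local v) => (ConjClasses.mk γ) ∈ S) := by
    intro c hc
    have hc' : c ∈ S := by simpa only [hmk] using hc
    exact hadm c ((hS c).1 hc')
  have hraoS : ∀ u ∈ S, ∀ f : ((cmDatum L 3 (Matrix.of fun i j : Fin 3 => if i.val + j.val + 1 = 3 then (1 : L) else 0)).Local v) → ℂ, IsLocSmooth f →
            Integrable (descConj (Quotient.out u : ((cmDatum L 3 (Matrix.of fun i j : Fin 3 => if i.val + j.val + 1 = 3 then (1 : L) else 0)).Local v)) (Subgroup.centralizer ({(Quotient.out u : ((cmDatum L 3 (Matrix.of fun i j : Fin 3 => if i.val + j.val + 1 = 3 then (1 : L) else 0)).Local v))} : Set ((cmDatum L 3 (Matrix.of fun i j : Fin 3 => if i.val + j.val + 1 = 3 then (1 : L) else 0)).Local v)))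
              (fun _ hg => Subgroup.mem_centralizer_singleton_iff.1 hg) f) (mU u) :=
    fun u hu => hraoU u (hunip u hu)
  obtain ⟨fd, hfd, h1, h0⟩ := hdual L v w hsub h2 S mU hunip hadmS hraoS
  exact ⟨S, mU, fd, hunip, hadmS, hraoS, hfd, h1, h0, hspan L v w hsub h2 S mU hS hadmS hraoS⟩

/-- **`n6nsShalikaOdd : N6nsShalikaOddStatement` — THE SHALIKA GERM EXPANSION FOR `U(Φ₃)(L⁺_v)` AT EVERY ODD NON-SPLIT PLACE, PROVED IN-HOUSE** (the narrowed row ★ p849113 by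
NAME): `n6nsShalikaOdd_of_organs` fed with ‹U-FIN› ★ p849177, ‹RAO› §1 `shRao_of_unipotent`, ‹DUAL› ★ p849114, ‹SPAN› §1 `shSpan_of_span`.  `--axioms` = TRIO.
[cite: Rogawski1990, §8.1 Prop. 8.1.1 p. 112] [cite: HarishChandra1999AdmissibleDistributions, Thm. 8.1 p. 48] [cite: Howe1974, Prop. 2] [cite: Rao1972, Theorem] -/
theorem n6nsShalikaOdd : Literature.NumberTheory.Rogawski1990.N6nsShalikaOddStatement :=
  n6nsShalikaOdd_of_organs Literature.NumberTheory.Rogawski1990.unitaryThree_unipotent_conjClasses_finite_odd shRao_of_unipotent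
    Literature.NumberTheory.Rogawski1990.UnitaryGroup.exists_unipotentDualPieces_antidiagOne_odd shSpan_of_span

/-- Statement tie: the head IS the row type by name. -/
example : Literature.NumberTheory.Rogawski1990.N6nsShalikaOddStatement := n6nsShalikaOdd

end Summit.HodgeConjecture.HodgeConjecture.Cruxes.H413.F0P3cN6nsShalikaOdd

end
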